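import Literature.MathematicalPhysics.QuantumManyBody.PeriodicBoseGas
import Mathlib.Analysis.SpecialFunctions.Integrals.Basic
import Mathlib.MeasureTheory.Integral.IntervalIntegral.IntegrationByParts
import Mathlib.MeasureTheory.Integral.Pi
import Mathlib.MeasureTheory.Measure.Haar.InnerProductSpace
import Mathlib.Analysis.SpecialFunctions.Trigonometric.Deriv
import HarnessLib

/-!
# The Neumann eigenbasis of the box: the cosine modes `c_n ℓ^{-1/2} cos(nπx/ℓ)` and their products

Topic `Literature/MathematicalPhysics/QuantumManyBody`, grouping namespace `NeumannBox`
(provefact `Literature.MathematicalPhysics.QuantumManyBody.BoseGas.Junge2026_neumannBox_pinnedLowerBound`).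
Every step of the printed proof of Junge's Theorem 4 beyond the a priori condensation estimate —
the momentum cut-offs `Q^L = 1_{𝒫_L}(√-Δ)`, `Q^H` and the spectral gaps of [FournaisEtAl2024,
§2.3, Thm. 2.3], the symmetrisation [FournaisEtAl2024, §2.5, Lemma 2.5], the second quantisation
[FournaisEtAl2024, Lemma 2.8] — is written in "the normalized eigenbasis of the Neumann
Laplacian on `Λ = [0,ℓ]³`", [FournaisEtAl2024, (2.20)]:
`u_p(x) = |Λ|^{-1/2} ∏_{i=1}^3 c_{p_i} cos(p_i x_i)`, `p ∈ (π/ℓ)ℕ₀³`, `c_0 = 1`, `c_{p_i} = √2`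
for `p_i ≠ 0`. Neither the tree nor Mathlib has this basis (Mathlib's `fourierBasis` is the
exponential basis of the circle). This file starts it — the one-dimensional factors and the
product modes — as real definitions with proved API:

* `cosCoeff n = c_n` (`1` for `n = 0`, `√2` otherwise), `waveNumber ℓ n = nπ/ℓ`,
  `cosMode ℓ n x = c_n ℓ^{-1/2} cos(nπx/ℓ)` — the `n`-th Neumann mode of `(0, ℓ)`;
* smoothness and derivatives: `hasDerivAt_cosMode` (`e_n' = -c_n ℓ^{-1/2} (nπ/ℓ) sin(nπx/ℓ)`),
  the **Neumann boundary condition** `deriv (cosMode ℓ n) 0 = deriv (cosMode ℓ n) ℓ = 0`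
  (`deriv_cosMode_zero`, `deriv_cosMode_self`), and the **eigenvalue equation**
  `e_n'' = -(nπ/ℓ)² e_n` (`hasDerivAt_deriv_cosMode`);
* **orthonormality** in `L²(0, ℓ)`: `∫₀^ℓ e_m e_n = δ_{mn}` (`integral_cosMode_mul_cosMode`), from
  `∫₀^ℓ cos(jπx/ℓ) dx = ℓ δ_{j0}` for `j ∈ ℤ` (`integral_cos_int_mul`) and the product formula;
* the **weak (form) eigenvalue identity** with no boundary condition on the test function:
  for every `f : ℝ → E` differentiable on `[0, ℓ]` with integrable derivative,
  `∫₀^ℓ e_n'(x) • f'(x) dx = (nπ/ℓ)² ∫₀^ℓ e_n(x) • f(x) dx`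
  (`integral_deriv_cosMode_smul_deriv`; integration by parts, the boundary terms vanishing by
  the Neumann condition of `e_n` — this is what makes `(e_n)` diagonalise the Neumann form
  `∫₀^ℓ |f'|²` on all of `H¹(0, ℓ)`);
* the sup bound `|e_n(x)| ≤ √(2/ℓ)` (`abs_cosMode_le`);
* the **three-dimensional modes** `mode ℓ k x = ∏ᵢ e_{kᵢ}(xᵢ)` (`= u_p`, `p = (π/ℓ)k`) on the
  one-particle space `Space = ℝ³` of the topic, with `mode ℓ 0 = ℓ^{-3/2}` (the condensate) and
  their **orthonormality on the cell** `[0,ℓ)³`: `∫_{cell ℓ} u_k u_{k'} = δ_{kk'}`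
  (`setIntegral_cell_mode_mul_mode`, Fubini over the three factors through the measure-preserving
  identification `ℝ³ ≃ (Fin 3 → ℝ)`).

Deliberately NOT here yet (next steps, same file): completeness of `(e_n)_{n ≥ 0}` in `L²(0,ℓ)`
and of `(u_k)` in `L²([0,ℓ)³)` (even reflection to the circle of length `2ℓ` and Mathlib's
`fourierBasis`), the three-dimensional form identity `∫ ∇u_k·∇f = (π/ℓ)²|k|² ∫ u_k f`, and the
momentum cut-offs `Q^L`, `Q^H` of [FournaisEtAl2024, (2.10)].

## References

* [FournaisEtAl2024] S. Fournais, L. Junge, T. Girardot, L. Morin, M. Olivieri, A. Triay, *The free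
  energy of dilute Bose gases at low temperatures interacting via strong potentials*,
  arXiv:2408.14222, Ann. Henri Poincaré (2026): (2.10), (2.20), Lemma 2.5, Lemma 2.8.
* [LSSY2005] E. H. Lieb, R. Seiringer, J. P. Solovej, J. Yngvason, *The Mathematics of the Bose Gas
  and its Condensation*, Birkhäuser 2005: Ch. 2, after (2.50) (`E₁⁽⁰⁾ = π²/ℓ²`, "the kinetic
  energy of a single particle in the first excited state in the box" with Neumann conditions).
-/

noncomputable section

open Real intervalIntegral MeasureTheory Set

namespace Literature.MathematicalPhysics.QuantumManyBody.NeumannBox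

/-! ### Definitions -/

/-- The normalisation constants of the Neumann cosine modes: `c_0 = 1`, `c_n = √2` for `n ≥ 1`.
[cite: FournaisEtAl2024, (2.20)] -/
def cosCoeff (n : ℕ) : ℝ := if n = 0 then 1 else Real.sqrt 2

/-- The `n`-th Neumann wave number `nπ/ℓ` of the interval `(0, ℓ)` (the momenta of the Neumann box
are `(π/ℓ)ℕ₀`). [cite: FournaisEtAl2024, (2.10) and (2.20)] -/
def waveNumber (ℓ : ℝ) (n : ℕ) : ℝ := n * π / ℓ

/-- The `n`-th **Neumann cosine mode** of the interval `(0, ℓ)`: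
`e_n(x) = c_n ℓ^{-1/2} cos(nπx/ℓ)` — the one-dimensional factor of the normalised eigenbasis
`u_p(x) = |Λ|^{-1/2} ∏ᵢ c_{pᵢ} cos(pᵢxᵢ)` of the Neumann Laplacian on `[0,ℓ]³`.
[cite: FournaisEtAl2024, (2.20)] -/
def cosMode (ℓ : ℝ) (n : ℕ) (x : ℝ) : ℝ :=
  cosCoeff n / Real.sqrt ℓ * Real.cos (waveNumber ℓ n * x)

/-! ### Constants -/

/-- `c_0 = 1`. [cite: FournaisEtAl2024, (2.20)] -/
theorem cosCoeff_zero : cosCoeff 0 = 1 := by simp [cosCoeff]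

/-- `c_n = √2` for `n ≠ 0`. [cite: FournaisEtAl2024, (2.20)] -/
theorem cosCoeff_of_ne_zero {n : ℕ} (hn : n ≠ 0) : cosCoeff n = Real.sqrt 2 := by
  simp [cosCoeff, hn]

/-- `c_n² = 1` or `2`. [cite: FournaisEtAl2024, (2.20)] -/
theorem cosCoeff_sq (n : ℕ) : cosCoeff n ^ 2 = if n = 0 then 1 else 2 := by
  by_cases hn : n = 0
  · simp [cosCoeff, hn]
  · simp [cosCoeff, hn, Real.sq_sqrt]

/-- `c_n > 0`. [cite: FournaisEtAl2024, (2.20)] -/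
theorem cosCoeff_pos (n : ℕ) : 0 < cosCoeff n := by
  by_cases hn : n = 0 <;> simp [cosCoeff, hn]

/-- `c_n ≤ √2`. [cite: FournaisEtAl2024, (2.20)] -/
theorem cosCoeff_le (n : ℕ) : cosCoeff n ≤ Real.sqrt 2 := by
  by_cases hn : n = 0
  · simp only [cosCoeff, hn, if_true]
    exact Real.one_le_sqrt.2 (by norm_num)
  · simp [cosCoeff, hn]

/-- The zero mode has wave number `0`. [folklore] -/
theorem waveNumber_zero (ℓ : ℝ) : waveNumber ℓ 0 = 0 := by simp [waveNumber]

/-- `(nπ/ℓ)·ℓ = nπ`. [folklore] -/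
theorem waveNumber_mul_self {ℓ : ℝ} (hℓ : ℓ ≠ 0) (n : ℕ) : waveNumber ℓ n * ℓ = n * π := by
  unfold waveNumber; field_simp

/-- The zero mode is the normalised constant `ℓ^{-1/2}`. [cite: FournaisEtAl2024, (2.20)] -/
theorem cosMode_zero {ℓ : ℝ} (x : ℝ) : cosMode ℓ 0 x = 1 / Real.sqrt ℓ := by
  simp [cosMode, cosCoeff, waveNumber]

/-- The sup bound `|e_n(x)| ≤ √(2/ℓ)` (`ℓ > 0`). [folklore] -/
theorem abs_cosMode_le {ℓ : ℝ} (hℓ : 0 < ℓ) (n : ℕ) (x : ℝ) :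
    |cosMode ℓ n x| ≤ Real.sqrt (2 / ℓ) := by
  unfold cosMode
  rw [abs_mul, abs_div, abs_of_pos (cosCoeff_pos n), abs_of_pos (Real.sqrt_pos.2 hℓ),
    Real.sqrt_div' _ hℓ.le]
  calc cosCoeff n / Real.sqrt ℓ * |Real.cos (waveNumber ℓ n * x)|
      ≤ cosCoeff n / Real.sqrt ℓ * 1 := by
        gcongr
        · exact div_nonneg (cosCoeff_pos n).le (Real.sqrt_nonneg _)
        · exact Real.abs_cos_le_one _
    _ ≤ Real.sqrt 2 / Real.sqrt ℓ := by
        rw [mul_one]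
        gcongr
        exact cosCoeff_le n

/-! ### Derivatives, the Neumann condition and the eigenvalue equation -/

/-- The modes are smooth. [folklore] -/
theorem contDiff_cosMode (ℓ : ℝ) (n : ℕ) {k : ℕ∞} : ContDiff ℝ k (cosMode ℓ n) := by
  unfold cosMode
  fun_prop

/-- `e_n'(x) = -c_n ℓ^{-1/2} (nπ/ℓ) sin(nπx/ℓ)`. [folklore] -/
theorem hasDerivAt_cosMode (ℓ : ℝ) (n : ℕ) (x : ℝ) :
    HasDerivAt (cosMode ℓ n)
      (-(cosCoeff n / Real.sqrt ℓ) * waveNumber ℓ n * Real.sin (waveNumber ℓ n * x)) x := by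
  have h1 : HasDerivAt (fun y : ℝ => waveNumber ℓ n * y) (waveNumber ℓ n) x := by
    simpa using (hasDerivAt_id x).const_mul (waveNumber ℓ n)
  have h2 := (h1.cos).const_mul (cosCoeff n / Real.sqrt ℓ)
  refine h2.congr_deriv ?_
  ring

/-- The derivative as a function. [folklore] -/
theorem deriv_cosMode (ℓ : ℝ) (n : ℕ) :
    deriv (cosMode ℓ n) =
      fun x => -(cosCoeff n / Real.sqrt ℓ) * waveNumber ℓ n * Real.sin (waveNumber ℓ n * x) :=
  funext fun x => (hasDerivAt_cosMode ℓ n x).deriv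

/-- **Neumann condition at `0`**: `e_n'(0) = 0`. [cite: LSSY2005, Ch. 2, after (2.50)] -/
theorem deriv_cosMode_zero (ℓ : ℝ) (n : ℕ) : deriv (cosMode ℓ n) 0 = 0 := by
  rw [deriv_cosMode]; simp

/-- **Neumann condition at `ℓ`**: `e_n'(ℓ) = 0` (`sin(nπ) = 0`). [cite: LSSY2005, Ch. 2, after (2.50)] -/
theorem deriv_cosMode_self {ℓ : ℝ} (hℓ : ℓ ≠ 0) (n : ℕ) : deriv (cosMode ℓ n) ℓ = 0 := by
  rw [deriv_cosMode]
  simp only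
  rw [waveNumber_mul_self hℓ, Real.sin_nat_mul_pi, mul_zero]

/-- **The eigenvalue equation** `e_n'' = -(nπ/ℓ)² e_n` (`-e_n'' = (nπ/ℓ)² e_n`: the modes are
eigenfunctions of `-d²/dx²` with the Neumann eigenvalues `(nπ/ℓ)²`, the first non-zero one
being `π²/ℓ²`). [cite: LSSY2005, Ch. 2, after (2.50)] -/
theorem hasDerivAt_deriv_cosMode (ℓ : ℝ) (n : ℕ) (x : ℝ) :
    HasDerivAt (deriv (cosMode ℓ n)) (-(waveNumber ℓ n) ^ 2 * cosMode ℓ n x) x := by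
  rw [deriv_cosMode]
  have h1 : HasDerivAt (fun y : ℝ => waveNumber ℓ n * y) (waveNumber ℓ n) x := by
    simpa using (hasDerivAt_id x).const_mul (waveNumber ℓ n)
  have h2 := (h1.sin).const_mul (-(cosCoeff n / Real.sqrt ℓ) * waveNumber ℓ n)
  refine h2.congr_deriv ?_
  unfold cosMode
  ring

/-! ### Orthonormality -/

/-- `∫₀^ℓ cos(jπx/ℓ) dx = ℓ δ_{j0}` for `j ∈ ℤ` (`ℓ > 0`). [folklore] -/
theorem integral_cos_int_mul {ℓ : ℝ} (hℓ : 0 < ℓ) (j : ℤ) :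
    ∫ x in (0 : ℝ)..ℓ, Real.cos (j * π / ℓ * x) = if j = 0 then ℓ else 0 := by
  split_ifs with hj
  · subst hj; simp
  · have hc : (j : ℝ) * π / ℓ ≠ 0 := by
      have : (j : ℝ) ≠ 0 := by exact_mod_cast hj
      positivity
    rw [intervalIntegral.integral_comp_mul_left (fun x => Real.cos x) hc, integral_cos]
    simp only [mul_zero, Real.sin_zero, sub_zero, smul_eq_mul]
    rw [show (j : ℝ) * π / ℓ * ℓ = j * π by field_simp, Real.sin_int_mul_pi, mul_zero]

/-- `∫₀^ℓ cos(mπx/ℓ)cos(nπx/ℓ) dx = (ℓ/2)(δ_{mn} + δ_{m+n,0})` (product formula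
`cos a cos b = ½(cos(a-b) + cos(a+b))`). [folklore] -/
theorem integral_cos_waveNumber_mul_cos_waveNumber {ℓ : ℝ} (hℓ : 0 < ℓ) (m n : ℕ) :
    ∫ x in (0 : ℝ)..ℓ, Real.cos (waveNumber ℓ m * x) * Real.cos (waveNumber ℓ n * x) =
      (if m = n then ℓ / 2 else 0) + (if m + n = 0 then ℓ / 2 else 0) := by
  have hprod : ∀ x : ℝ, Real.cos (waveNumber ℓ m * x) * Real.cos (waveNumber ℓ n * x) =
      (1 / 2) * Real.cos (((m : ℤ) - n : ℤ) * π / ℓ * x) +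
        (1 / 2) * Real.cos (((m : ℤ) + n : ℤ) * π / ℓ * x) := by
    intro x
    have h1 : (((m : ℤ) - n : ℤ) : ℝ) * π / ℓ * x = waveNumber ℓ m * x - waveNumber ℓ n * x := by
      push_cast; unfold waveNumber; ring
    have h2 : (((m : ℤ) + n : ℤ) : ℝ) * π / ℓ * x = waveNumber ℓ m * x + waveNumber ℓ n * x := by
      push_cast; unfold waveNumber; ring
    rw [h1, h2, Real.cos_sub, Real.cos_add]; ring
  simp_rw [hprod]
  rw [intervalIntegral.integral_add (Continuous.intervalIntegrable (by fun_prop) _ _)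
      (Continuous.intervalIntegrable (by fun_prop) _ _),
    intervalIntegral.integral_const_mul, intervalIntegral.integral_const_mul,
    integral_cos_int_mul hℓ, integral_cos_int_mul hℓ]
  have e1 : ((m : ℤ) - n = 0) ↔ m = n := by omega
  have e2 : ((m : ℤ) + n = 0) ↔ m + n = 0 := by omega
  rw [show ((if (m : ℤ) - n = 0 then ℓ else 0 : ℝ)) = if m = n then ℓ else 0 by simp only [e1],
    show ((if (m : ℤ) + n = 0 then ℓ else 0 : ℝ)) = if m + n = 0 then ℓ else 0 by simp only [e2]]
  split_ifs <;> ring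

/-- **Orthonormality of the Neumann cosine modes**: `∫₀^ℓ e_m(x) e_n(x) dx = δ_{mn}` (`ℓ > 0`).
[cite: FournaisEtAl2024, (2.20)] -/
theorem integral_cosMode_mul_cosMode {ℓ : ℝ} (hℓ : 0 < ℓ) (m n : ℕ) :
    ∫ x in (0 : ℝ)..ℓ, cosMode ℓ m x * cosMode ℓ n x = if m = n then 1 else 0 := by
  have hden : Real.sqrt ℓ * Real.sqrt ℓ = ℓ := Real.mul_self_sqrt hℓ.le
  have hsℓ0 : 0 < Real.sqrt ℓ := Real.sqrt_pos.2 hℓ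
  have hℓ0 : ℓ ≠ 0 := hℓ.ne'
  have hfac : ∀ x, cosMode ℓ m x * cosMode ℓ n x =
      (cosCoeff m * cosCoeff n / ℓ) *
        (Real.cos (waveNumber ℓ m * x) * Real.cos (waveNumber ℓ n * x)) := by
    intro x
    unfold cosMode
    rw [show cosCoeff m / Real.sqrt ℓ * Real.cos (waveNumber ℓ m * x) *
        (cosCoeff n / Real.sqrt ℓ * Real.cos (waveNumber ℓ n * x)) =
        cosCoeff m * cosCoeff n / (Real.sqrt ℓ * Real.sqrt ℓ) *
          (Real.cos (waveNumber ℓ m * x) * Real.cos (waveNumber ℓ n * x)) by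
      field_simp, hden]
  simp_rw [hfac]
  rw [intervalIntegral.integral_const_mul, integral_cos_waveNumber_mul_cos_waveNumber hℓ]
  rcases eq_or_ne m n with h | h
  · subst h
    rw [if_pos rfl, if_pos rfl]
    rcases eq_or_ne m 0 with h0 | h0
    · subst h0
      rw [if_pos rfl, cosCoeff_zero]
      field_simp
      ring
    · rw [if_neg (by omega : m + m ≠ 0), cosCoeff_of_ne_zero h0, add_zero,
        Real.mul_self_sqrt (by norm_num : (0 : ℝ) ≤ 2)]
      field_simp
  · rw [if_neg h, if_neg h, if_neg (by omega : m + n ≠ 0), add_zero, mul_zero]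

/-- In particular the modes are normalised: `∫₀^ℓ e_n² = 1`. [cite: FournaisEtAl2024, (2.20)] -/
theorem integral_cosMode_sq {ℓ : ℝ} (hℓ : 0 < ℓ) (n : ℕ) :
    ∫ x in (0 : ℝ)..ℓ, cosMode ℓ n x ^ 2 = 1 := by
  simp_rw [pow_two]
  rw [integral_cosMode_mul_cosMode hℓ, if_pos rfl]

/-! ### The weak eigenvalue identity (no boundary condition on the test function) -/

variable {E : Type*} [NormedAddCommGroup E] [NormedSpace ℝ E] [CompleteSpace E]

/-- **The form identity** making `(e_n)` diagonalise the Neumann form: for every `f : ℝ → E`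
differentiable on `[0, ℓ]` with interval-integrable derivative `f'` (no boundary condition),
`∫₀^ℓ e_n'(x) • f'(x) dx = (nπ/ℓ)² ∫₀^ℓ e_n(x) • f(x) dx` — integration by parts, the boundary
terms `e_n'(ℓ) • f(ℓ) - e_n'(0) • f(0)` vanishing by the Neumann condition of `e_n`, and
`-e_n'' = (nπ/ℓ)² e_n`. [cite: LSSY2005, Ch. 2, after (2.50)] -/
theorem integral_deriv_cosMode_smul_deriv {ℓ : ℝ} (hℓ : 0 < ℓ) (n : ℕ) {f f' : ℝ → E}
    (hf : ∀ x ∈ uIcc (0 : ℝ) ℓ, HasDerivAt f (f' x) x)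
    (hf' : IntervalIntegrable f' volume 0 ℓ) :
    ∫ x in (0 : ℝ)..ℓ, deriv (cosMode ℓ n) x • f' x =
      waveNumber ℓ n ^ 2 • ∫ x in (0 : ℝ)..ℓ, cosMode ℓ n x • f x := by
  have hcont : Continuous fun x => -(waveNumber ℓ n) ^ 2 * cosMode ℓ n x :=
    continuous_const.mul (contDiff_cosMode ℓ n (k := 0)).continuous
  have hparts := intervalIntegral.integral_smul_deriv_eq_deriv_smul (a := 0) (b := ℓ)
    (u := deriv (cosMode ℓ n)) (u' := fun x => -(waveNumber ℓ n) ^ 2 * cosMode ℓ n x)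
    (fun x _ => hasDerivAt_deriv_cosMode ℓ n x) hf (hcont.intervalIntegrable _ _) hf'
  rw [hparts, deriv_cosMode_zero, deriv_cosMode_self hℓ.ne', zero_smul, zero_smul, sub_zero,
    zero_sub, ← intervalIntegral.integral_neg, ← intervalIntegral.integral_smul]
  congr 1
  funext x
  rw [smul_smul, neg_mul, neg_smul, neg_neg]

/-! ### The three-dimensional modes `u_p` on the box -/

section Box

open Literature.MathematicalPhysics.QuantumManyBody.BoseGas

/-- **The normalised Neumann eigenbasis of the box** `[0,ℓ]³`:
`u_k(x) = ∏_{i=1}^3 e_{kᵢ}(xᵢ) = ℓ^{-3/2} ∏ᵢ c_{kᵢ} cos(kᵢπxᵢ/ℓ)`, `k ∈ ℕ₀³` (momentum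
`p = (π/ℓ)k ∈ (π/ℓ)ℕ₀³`), on the one-particle space `Space = ℝ³`. [cite: FournaisEtAl2024, (2.20)] -/
def mode (ℓ : ℝ) (k : Fin 3 → ℕ) (x : Space) : ℝ :=
  ∏ i : Fin 3, cosMode ℓ (k i) (x i)

/-- The zero mode is the normalised constant `ℓ^{-3/2}` (the condensate wave function, range of
`P`). [cite: FournaisEtAl2024, (2.9) and (2.20)] -/
theorem mode_zero {ℓ : ℝ} (x : Space) : mode ℓ 0 x = (1 / Real.sqrt ℓ) ^ 3 := by
  simp [mode, cosMode_zero]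

/-- The one-dimensional orthonormality as a set integral over `[0, ℓ)`. [cite: FournaisEtAl2024, (2.20)] -/
theorem setIntegral_Ico_cosMode_mul_cosMode {ℓ : ℝ} (hℓ : 0 < ℓ) (m n : ℕ) :
    ∫ x in Ico (0 : ℝ) ℓ, cosMode ℓ m x * cosMode ℓ n x = if m = n then 1 else 0 := by
  rw [integral_Ico_eq_integral_Ioc, ← intervalIntegral.integral_of_le hℓ.le,
    integral_cosMode_mul_cosMode hℓ]

/-- **Orthonormality of the Neumann eigenbasis of the box**: `∫_{[0,ℓ)³} u_k u_{k'} = δ_{kk'}`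
(`ℓ > 0`; Fubini over the three factors). [cite: FournaisEtAl2024, (2.20) and Lemma 2.5] -/
theorem setIntegral_cell_mode_mul_mode {ℓ : ℝ} (hℓ : 0 < ℓ) (k k' : Fin 3 → ℕ) :
    ∫ x in cell ℓ, mode ℓ k x * mode ℓ k' x = if k = k' then 1 else 0 := by
  set e := (MeasurableEquiv.toLp 2 (Fin 3 → ℝ)).symm with he
  have hmp : MeasurePreserving e volume volume :=
    EuclideanSpace.volume_preserving_symm_measurableEquiv_toLp (Fin 3)
  have hcell : cell ℓ = e ⁻¹' (Set.univ.pi fun _ => Ico (0 : ℝ) ℓ) := by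
    ext x; simp [cell, he]
  set G : (Fin 3 → ℝ) → ℝ := fun y => ∏ i : Fin 3, (cosMode ℓ (k i) (y i) * cosMode ℓ (k' i) (y i))
    with hG
  have hint : ∀ x : Space, mode ℓ k x * mode ℓ k' x = G (e x) := by
    intro x
    simp only [mode, hG, he, MeasurableEquiv.coe_toLp_symm, ← Finset.prod_mul_distrib]
  simp_rw [hint]
  rw [hcell, hmp.setIntegral_preimage_emb e.measurableEmbedding G, volume_pi,
    Measure.restrict_pi_pi, hG, integral_fintype_prod_eq_prod
      (fun i (t : ℝ) => cosMode ℓ (k i) t * cosMode ℓ (k' i) t)]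
  simp_rw [setIntegral_Ico_cosMode_mul_cosMode hℓ]
  by_cases h : k = k'
  · subst h; simp
  · rw [if_neg h]
    obtain ⟨i, hi⟩ : ∃ i, k i ≠ k' i := not_forall.1 fun hc => h (funext hc)
    exact Finset.prod_eq_zero (Finset.mem_univ i) (if_neg hi)

/-- In particular `∫_{[0,ℓ)³} u_k² = 1`. [cite: FournaisEtAl2024, (2.20)] -/
theorem setIntegral_cell_mode_sq {ℓ : ℝ} (hℓ : 0 < ℓ) (k : Fin 3 → ℕ) :
    ∫ x in cell ℓ, mode ℓ k x ^ 2 = 1 := by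
  simp_rw [pow_two]
  rw [setIntegral_cell_mode_mul_mode hℓ, if_pos rfl]

end Box

end Literature.MathematicalPhysics.QuantumManyBody.NeumannBox

end
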